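import Literature.NumberTheory.Automorphic.QuaternionAlgebraUniqueness
import Literature.NumberTheory.Automorphic.QuaternionAlgebraStructure
import Literature.NumberTheory.QuadraticForms.QuadraticNormIndexLocal
import Literature.NumberTheory.QuadraticForms.QuadraticNormLocalCFT
import HarnessLib

/-!
# Uniqueness of the local quaternion division algebra, reduced to the local norm index

Companion ("proofs") file of `QuaternionAlgebraClassification` for its named fact
`nonempty_algEquiv_adicCompletion_of_division` (Vignéras, LNM 800, Ch. II §1 Thm. 1.1: *over a
local field `K_v ≠ ℂ` there is exactly one quaternion division algebra up to isomorphism*;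
O'Meara 63:11b), one of the three remaining leaves of the uniqueness half of Vignéras III §3
Thm. 3.1 (`nonempty_algEquiv_of_ramifiedPlaces_eq`, see `QuaternionAlgebraUniqueness`). All
declarations here are theorems.

We reduce II Thm. 1.1 to the **local norm index** `(K_vˣ : N(K_v(√a)ˣ)) = 2` for non-squares
`a ∈ K_v` (O'Meara 63:13a), in the vocabulary `quadraticNormSubgroup` of
`Literature/NumberTheory/QuadraticForms/QuadraticNormIndex`. That index is `2`

* at every **non-dyadic** place, proved outright in `QuadraticNormIndexLocal`
  (`index_quadraticNormSubgroup_eq_two`), and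
* at **every** place granted the fundamental equality of local class field theory
  `[Fˣ : N_{E/F}(Eˣ)] = [E : F]` for abelian `E/F` (the named fact
  `index_normSubgroup_eq_finrank (v.adicCompletion K)` of
  `Literature/NumberTheory/GaloisRepresentations/LocalExistenceTheorem`, Serre *Local Fields*
  XIII §4 Prop. 9), by `index_quadraticNormSubgroup_eq_two_of_index_normSubgroup_eq_finrank` of
  `QuadraticNormLocalCFT`.

Hence: II Thm. 1.1 is **proved at every place `v ∤ 2`**
(`nonempty_algEquiv_adicCompletion_of_division_of_not_mem`) and follows in general from the local
fundamental equality (`nonempty_algEquiv_adicCompletion_of_division_of_index_normSubgroup_eq_finrank`).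

The reduction (over any field `F` with `2 ≠ 0`; `n(F(√a))` = `IsNormFromSqrt a` of
`QuaternionAlgebraHasse`, `{F(√a), θ} = ℍ[F,a,θ]`):

* `QuaternionAlgebra.nonempty_algEquiv_swap` : `ℍ[F,a,b] ≃ₐ[F] ℍ[F,b,a]`.
* `exists_not_isNormFromSqrt_and` : if `b ∉ n(F(√a))` and `b' ∉ n(F(√a'))` there is `c ≠ 0` in
  neither norm group (a group is not the union of two proper subgroups).
* `exists_isNormFromSqrt_chain`, `QuaternionAlgebra.nonempty_algEquiv_of_not_isNormFromSqrt` : if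
  two non-norms from `F(√a)`, `a` a non-square, always differ by a norm (index `≤ 2`), then any
  two quaternion algebras `ℍ[F,a,b]`, `ℍ[F,a',b']` with `b ∉ n(F(√a))`, `b' ∉ n(F(√a'))` (i.e.
  division algebras, I Cor. 2.4) are isomorphic, by the chain
  `ℍ[a,b] ≃ ℍ[a,c] ≃ ℍ[c,a] ≃ ℍ[c,a'] ≃ ℍ[a',c] ≃ ℍ[a',b']`
  (rescaling `{L, θ} ≃ {L, θ n(m)}`, `QuaternionAlgebra.nonempty_algEquiv_rescale`, and swaps).
* `nonempty_algEquiv_of_division_of_norm` : the same for abstract quaternion division algebras,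
  through the structure theorem `D ≃ ℍ[F,a,b]` (`QuaternionAlgebraStructure`).
* `isNormFromSqrt_div_of_index_eq_two` : the subgroup form `(quadraticNormSubgroup F a).index = 2`
  implies the predicate form used above.

## References

* M.-F. Vignéras, *Arithmétique des algèbres de quaternions*, LNM 800 (1980), Ch. I §1 (rescaling
  `u ↦ m u`), §2 Cor. 2.4; Ch. II §1 Thm. 1.1.
* O. T. O'Meara, *Introduction to quadratic forms*, Grundlehren 117 (1963), §63B: 63:11b
  (PDF p. 170), 63:13a (PDF p. 171).
* J.-P. Serre, *Local Fields*, GTM 67 (1979), Ch. XIII §4 Prop. 9.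
-/

noncomputable section

open scoped Quaternion
open NumberField IsDedekindDomain

universe u v

namespace Literature.NumberTheory.Automorphic

/-! ### Algebra over a field with `2 ≠ 0` -/

section Field

variable {F : Type*} [Field F]

/-- **`{i, j} ↦ {j, i}`**: `ℍ[F,a,b] ≃ₐ[F] ℍ[F,b,a]`, the coordinate swap
`(w, x, y, z) ↦ (w, y, x, -z)` (`i ↦ j'`, `j ↦ i'`, `k = ij ↦ j'i' = -k'`). [folklore] -/
theorem QuaternionAlgebra.nonempty_algEquiv_swap (a b : F) :
    Nonempty (ℍ[F,a,b] ≃ₐ[F] ℍ[F,b,a]) := by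
  let f : ℍ[F,a,b] ≃ₗ[F] ℍ[F,b,a] :=
    { toFun := fun x ↦ ⟨x.re, x.imJ, x.imI, -x.imK⟩
      invFun := fun x ↦ ⟨x.re, x.imJ, x.imI, -x.imK⟩
      map_add' := fun x y ↦ by ext <;> simp [add_comm]
      map_smul' := fun c x ↦ by ext <;> simp
      left_inv := fun x ↦ by ext <;> simp
      right_inv := fun x ↦ by ext <;> simp }
  have hf : ∀ x, f x = ⟨x.re, x.imJ, x.imI, -x.imK⟩ := fun x ↦ rfl
  exact ⟨AlgEquiv.ofLinearEquiv f (by rw [hf]; ext <;> simp)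
    (fun x y ↦ by rw [hf, hf, hf]; ext <;> simp <;> ring)⟩

/-- **A group is not the union of two proper subgroups**, for the norm groups `n(F(√a))`,
`n(F(√a'))` inside `Fˣ`: if `b ∉ n(F(√a))` and `b' ∉ n(F(√a'))` (`b, b' ≠ 0`), some `c ≠ 0` lies
in neither (`c = b`, `b'` or `b b'`). [folklore] -/
theorem exists_not_isNormFromSqrt_and {a a' b b' : F} (hb : b ≠ 0) (hb' : b' ≠ 0)
    (hab : ¬ IsNormFromSqrt a b) (hab' : ¬ IsNormFromSqrt a' b') :
    ∃ c : F, c ≠ 0 ∧ ¬ IsNormFromSqrt a c ∧ ¬ IsNormFromSqrt a' c := by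
  by_cases h₁ : IsNormFromSqrt a' b
  · by_cases h₂ : IsNormFromSqrt a b'
    · refine ⟨b * b', mul_ne_zero hb hb', fun h ↦ hab ?_, fun h ↦ hab' ?_⟩
      · have h' := h.div h₂
        rwa [mul_div_assoc, div_self hb', mul_one] at h'
      · have h' := h.div h₁
        rwa [mul_comm, mul_div_assoc, div_self hb, mul_one] at h'
    · exact ⟨b', hb', h₂, hab'⟩
  · exact ⟨b, hb, hab, h₁⟩

/-- Symmetry of the norm criterion (`(a, c)_F = (c, a)_F`, O'Meara §63B): for `a c ≠ 0` and
`2 ≠ 0`, `c ∈ n(F(√a))` implies `a ∈ n(F(√c))`. [folklore] -/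
theorem IsNormFromSqrt.symm_of [NeZero (2 : F)] {a c : F} (ha : a ≠ 0) (hc : c ≠ 0)
    (h : IsNormFromSqrt a c) : IsNormFromSqrt c a := by
  rw [isNormFromSqrt_iff_hilbertSymbol_eq_one hc ha, QuadraticForms.hilbertSymbol_comm]
  exact (isNormFromSqrt_iff_hilbertSymbol_eq_one ha hc).mp h

/-- Rescaling in quotient form: if `θ'/θ ∈ n(F(√a))` (`θ θ' ≠ 0`) then `ℍ[F,a,θ'] ≃ₐ[F] ℍ[F,a,θ]`
(Vignéras I §1, `{L, θ n(m)} ≃ {L, θ}`; `QuaternionAlgebra.nonempty_algEquiv_rescale`).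
[cite: VignerasLNM800, Ch. I §1] -/
theorem QuaternionAlgebra.nonempty_algEquiv_of_isNormFromSqrt_div {a θ θ' : F} (hθ : θ ≠ 0)
    (hθ' : θ' ≠ 0) (hN : IsNormFromSqrt a (θ' / θ)) : Nonempty (ℍ[F,a,θ'] ≃ₐ[F] ℍ[F,a,θ]) := by
  obtain ⟨p, q, hpq⟩ := isNormFromSqrt_iff.mp hN
  refine QuaternionAlgebra.nonempty_algEquiv_rescale p q ?_ ?_
  · rw [← hpq]
    exact div_ne_zero hθ' hθ
  · rw [← hpq, mul_div_assoc', mul_comm, mul_div_assoc, div_self hθ, mul_one]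

/-- **The chain data.** Suppose that for every non-square `a ≠ 0`, two non-norms from `F(√a)`
differ by a norm (`(Fˣ : n(F(√a)ˣ)) ≤ 2`; O'Meara 63:13a over a local field). For
`a b a' b' ≠ 0` with `b ∉ n(F(√a))`, `b' ∉ n(F(√a'))` there is `c ≠ 0` with `c/b ∈ n(F(√a))`,
`c/b' ∈ n(F(√a'))` and `a'/a ∈ n(F(√c))`: pick `c` outside both norm groups
(`exists_not_isNormFromSqrt_and`); by symmetry of the Hilbert symbol `a, a' ∉ n(F(√c))` and `c`
is a non-square. These relations make the chain of isomorphisms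
`ℍ[a,b] ≃ ℍ[a,c] ≃ ℍ[c,a] ≃ ℍ[c,a'] ≃ ℍ[a',c] ≃ ℍ[a',b']` below, and they persist in every
field extension of `F`. [folklore] -/
theorem exists_isNormFromSqrt_chain [NeZero (2 : F)]
    (hF : ∀ a θ θ' : F, a ≠ 0 → ¬ IsSquare a → θ ≠ 0 → θ' ≠ 0 →
      ¬ IsNormFromSqrt a θ → ¬ IsNormFromSqrt a θ' → IsNormFromSqrt a (θ' / θ))
    {a b a' b' : F} (ha : a ≠ 0) (hb : b ≠ 0) (ha' : a' ≠ 0) (hb' : b' ≠ 0)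
    (hab : ¬ IsNormFromSqrt a b) (hab' : ¬ IsNormFromSqrt a' b') :
    ∃ c : F, c ≠ 0 ∧ IsNormFromSqrt a (c / b) ∧ IsNormFromSqrt a' (c / b') ∧
      IsNormFromSqrt c (a' / a) := by
  have hasq : ¬ IsSquare a := fun h ↦ hab (IsNormFromSqrt.of_isSquare h ha b)
  have hasq' : ¬ IsSquare a' := fun h ↦ hab' (IsNormFromSqrt.of_isSquare h ha' b')
  obtain ⟨c, hc, hac, hac'⟩ := exists_not_isNormFromSqrt_and hb hb' hab hab'
  have hca : ¬ IsNormFromSqrt c a := fun h ↦ hac (h.symm_of hc ha)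
  have hca' : ¬ IsNormFromSqrt c a' := fun h ↦ hac' (h.symm_of hc ha')
  have hcsq : ¬ IsSquare c := fun h ↦ hca (IsNormFromSqrt.of_isSquare h hc a)
  exact ⟨c, hc, hF a b c ha hasq hb hc hab hac, hF a' b' c ha' hasq' hb' hc hab' hac',
    hF c a a' hc hcsq ha ha' hca hca'⟩

/-- **Uniqueness of the quaternion division algebra from the norm index** (the algebra behind
O'Meara 63:11b / Vignéras II Thm. 1.1). Let `F` be a field with `2 ≠ 0` in which, for every
non-square `a`, two non-norms from `F(√a)` differ by a norm. Then for `a b a' b' ≠ 0` with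
`b ∉ n(F(√a))` and `b' ∉ n(F(√a'))` — i.e. `ℍ[F,a,b]` and `ℍ[F,a',b']` division algebras,
I Cor. 2.4 — `ℍ[F,a,b] ≃ₐ[F] ℍ[F,a',b']`: with `c` as in `exists_isNormFromSqrt_chain`,
`ℍ[a,b] ≃ ℍ[a,c] ≃ ℍ[c,a] ≃ ℍ[c,a'] ≃ ℍ[a',c] ≃ ℍ[a',b']` by rescaling
(`QuaternionAlgebra.nonempty_algEquiv_of_isNormFromSqrt_div`) and swapping
(`QuaternionAlgebra.nonempty_algEquiv_swap`). [folklore] -/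
theorem QuaternionAlgebra.nonempty_algEquiv_of_not_isNormFromSqrt [NeZero (2 : F)]
    (hF : ∀ a θ θ' : F, a ≠ 0 → ¬ IsSquare a → θ ≠ 0 → θ' ≠ 0 →
      ¬ IsNormFromSqrt a θ → ¬ IsNormFromSqrt a θ' → IsNormFromSqrt a (θ' / θ))
    {a b a' b' : F} (ha : a ≠ 0) (hb : b ≠ 0) (ha' : a' ≠ 0) (hb' : b' ≠ 0)
    (hab : ¬ IsNormFromSqrt a b) (hab' : ¬ IsNormFromSqrt a' b') :
    Nonempty (ℍ[F,a,b] ≃ₐ[F] ℍ[F,a',b']) := by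
  obtain ⟨c, hc, h₁, h₂, h₃⟩ := exists_isNormFromSqrt_chain hF ha hb ha' hb' hab hab'
  obtain ⟨e₁⟩ := QuaternionAlgebra.nonempty_algEquiv_of_isNormFromSqrt_div hb hc h₁
  obtain ⟨e₂⟩ := QuaternionAlgebra.nonempty_algEquiv_of_isNormFromSqrt_div hb' hc h₂
  obtain ⟨e₃⟩ := QuaternionAlgebra.nonempty_algEquiv_of_isNormFromSqrt_div ha ha' h₃
  obtain ⟨s₁⟩ := QuaternionAlgebra.nonempty_algEquiv_swap (F := F) a c
  obtain ⟨s₂⟩ := QuaternionAlgebra.nonempty_algEquiv_swap (F := F) c a'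
  -- `e₁ : ℍ[a,c] ≃ ℍ[a,b]`, `e₂ : ℍ[a',c] ≃ ℍ[a',b']`, `e₃ : ℍ[c,a'] ≃ ℍ[c,a]`
  exact ⟨e₁.symm.trans <| s₁.trans <| e₃.symm.trans <| s₂.trans e₂⟩

/-- A quaternion algebra `D ≃ ℍ[F,a,b]` (`a b ≠ 0`, `2 ≠ 0`) which is a division algebra has
`b ∉ n(F(√a))`: otherwise `ℍ[F,a,b] ≃ M₂(F)` (I Cor. 2.4,
`QuaternionAlgebra.nonempty_algEquiv_matrix_iff`) would contain the non-zero non-unit `E₁₁`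
(`IsQuaternionAlgebra.not_split_of_division`). [cite: VignerasLNM800, Ch. I §2 Cor. 2.4] -/
theorem not_isNormFromSqrt_of_division [NeZero (2 : F)] {a b : F} (ha : a ≠ 0) (hb : b ≠ 0)
    {D : Type*} [Ring D] [Algebra F D] (hD : ∀ x : D, x ≠ 0 → IsUnit x) (e : D ≃ₐ[F] ℍ[F,a,b]) :
    ¬ IsNormFromSqrt a b := by
  intro hN
  obtain ⟨x, y, hxy⟩ := isNormFromSqrt_iff.mp hN
  have hdiv : ∀ q : ℍ[F,a,b], q ≠ 0 → IsUnit q := fun q hq ↦ by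
    simpa using (hD (e.symm q) (by simpa using hq)).map e
  exact IsQuaternionAlgebra.not_split_of_division F hdiv
    ((QuaternionAlgebra.nonempty_algEquiv_matrix_iff ha hb).mpr ⟨x, y, hxy.symm⟩)

/-- **Two quaternion division algebras over `F` are isomorphic** whenever `F` (with `2 ≠ 0`)
satisfies the norm-index condition of `QuaternionAlgebra.nonempty_algEquiv_of_not_isNormFromSqrt`:
combine it with the structure theorem `D ≃ ℍ[F,a,b]`
(`IsQuaternionAlgebra.exists_algEquiv_quaternionAlgebra`) and `not_isNormFromSqrt_of_division`.
[cite: VignerasLNM800, Ch. II §1 Thm. 1.1] -/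
theorem nonempty_algEquiv_of_division_of_norm [NeZero (2 : F)]
    (hF : ∀ a θ θ' : F, a ≠ 0 → ¬ IsSquare a → θ ≠ 0 → θ' ≠ 0 →
      ¬ IsNormFromSqrt a θ → ¬ IsNormFromSqrt a θ' → IsNormFromSqrt a (θ' / θ))
    (A : Type u) [Ring A] [Algebra F A] [IsQuaternionAlgebra F A]
    (B : Type v) [Ring B] [Algebra F B] [IsQuaternionAlgebra F B]
    (hA : ∀ x : A, x ≠ 0 → IsUnit x) (hB : ∀ x : B, x ≠ 0 → IsUnit x) :
    Nonempty (A ≃ₐ[F] B) := by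
  obtain ⟨a, b, ha, hb, ⟨eA⟩⟩ := IsQuaternionAlgebra.exists_algEquiv_quaternionAlgebra F A
  obtain ⟨a', b', ha', hb', ⟨eB⟩⟩ := IsQuaternionAlgebra.exists_algEquiv_quaternionAlgebra F B
  obtain ⟨e⟩ := QuaternionAlgebra.nonempty_algEquiv_of_not_isNormFromSqrt hF ha hb ha' hb'
    (not_isNormFromSqrt_of_division ha hb hA eA) (not_isNormFromSqrt_of_division ha' hb' hB eB)
  exact ⟨eA.trans (e.trans eB.symm)⟩

/-- Dictionary between the subgroup `quadraticNormSubgroup F a ≤ Fˣ` of `QuadraticNormIndex`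
and the predicate `IsNormFromSqrt a` of `QuaternionAlgebraHasse`: for `t ≠ 0`,
`t ∈ quadraticNormSubgroup F a ↔ t ∈ n(F(√a))`. [folklore] -/
theorem mk0_mem_quadraticNormSubgroup_iff {a t : F} (ht : t ≠ 0) :
    Units.mk0 t ht ∈ QuadraticForms.quadraticNormSubgroup F a ↔ IsNormFromSqrt a t := by
  rw [QuadraticForms.mem_quadraticNormSubgroup_iff, isNormFromSqrt_iff, Units.val_mk0]
  constructor <;> rintro ⟨x, y, h⟩ <;> exact ⟨x, y, h.symm⟩

/-- From the subgroup form of the norm index to the predicate form: if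
`quadraticNormSubgroup F a` has index `2` in `Fˣ` then two non-norms `θ, θ'` from `F(√a)` have
`θ'/θ ∈ n(F(√a))` (Mathlib `Subgroup.mul_mem_iff_of_index_two`). [folklore] -/
theorem isNormFromSqrt_div_of_index_eq_two {a : F} (h2 : (QuadraticForms.quadraticNormSubgroup F a).index = 2)
    {θ θ' : F} (hθ : θ ≠ 0) (hθ' : θ' ≠ 0) (hn : ¬ IsNormFromSqrt a θ)
    (hn' : ¬ IsNormFromSqrt a θ') : IsNormFromSqrt a (θ' / θ) := by
  have h₁ : Units.mk0 θ' hθ' ∉ QuadraticForms.quadraticNormSubgroup F a := fun h ↦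
    hn' ((mk0_mem_quadraticNormSubgroup_iff hθ').mp h)
  have h₂ : (Units.mk0 θ hθ)⁻¹ ∉ QuadraticForms.quadraticNormSubgroup F a := fun h ↦
    hn ((mk0_mem_quadraticNormSubgroup_iff hθ).mp (by simpa using Subgroup.inv_mem _ h))
  have hq : Units.mk0 θ' hθ' * (Units.mk0 θ hθ)⁻¹ ∈ QuadraticForms.quadraticNormSubgroup F a :=
    (Subgroup.mul_mem_iff_of_index_two h2).mpr (iff_of_false h₁ h₂)
  obtain ⟨x, y, hxy⟩ := hq
  refine isNormFromSqrt_iff.mpr ⟨x, y, ?_⟩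
  rw [hxy, Units.val_mul, Units.val_inv_eq_inv_val, Units.val_mk0, Units.val_mk0, div_eq_mul_inv]

/-- **63:13a implies 63:13, predicate form**: if `quadraticNormSubgroup F a` has index `2` then
some `t ≠ 0` is not a norm from `F(√a)` (the norm group is a proper subgroup). [folklore] -/
theorem exists_not_isNormFromSqrt_of_index_eq_two {a : F}
    (h2 : (QuadraticForms.quadraticNormSubgroup F a).index = 2) : ∃ t : F, t ≠ 0 ∧ ¬ IsNormFromSqrt a t := by
  have hne : QuadraticForms.quadraticNormSubgroup F a ≠ ⊤ := fun htop ↦ by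
    rw [htop, Subgroup.index_top] at h2
    exact absurd h2 (by norm_num)
  obtain ⟨u, hu⟩ : ∃ u : Fˣ, u ∉ QuadraticForms.quadraticNormSubgroup F a := by
    by_contra! hall
    exact hne ((Subgroup.eq_top_iff' _).mpr hall)
  refine ⟨u, u.ne_zero, fun h ↦ hu ?_⟩
  rw [← Units.mk0_val u u.ne_zero]
  exact (mk0_mem_quadraticNormSubgroup_iff u.ne_zero).mpr h

/-- **Local uniqueness from the subgroup form of the norm index**: if `2 ≠ 0` in `F` and
`(Fˣ : quadraticNormSubgroup F a) = 2` for every non-square `a ≠ 0` (O'Meara 63:13a), any two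
quaternion division algebras over `F` are isomorphic (O'Meara 63:11b; Vignéras II Thm. 1.1).
[cite: VignerasLNM800, Ch. II §1 Thm. 1.1] -/
theorem nonempty_algEquiv_of_division_of_index_eq_two [NeZero (2 : F)]
    (hI : ∀ a : F, a ≠ 0 → ¬ IsSquare a → (QuadraticForms.quadraticNormSubgroup F a).index = 2)
    (A : Type u) [Ring A] [Algebra F A] [IsQuaternionAlgebra F A]
    (B : Type v) [Ring B] [Algebra F B] [IsQuaternionAlgebra F B]
    (hA : ∀ x : A, x ≠ 0 → IsUnit x) (hB : ∀ x : B, x ≠ 0 → IsUnit x) :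
    Nonempty (A ≃ₐ[F] B) :=
  nonempty_algEquiv_of_division_of_norm
    (fun a _ _ ha hasq hθ hθ' hn hn' ↦
      isNormFromSqrt_div_of_index_eq_two (hI a ha hasq) hθ hθ' hn hn') A B hA hB

end Field

/-! ### Assembly: Vignéras II Thm. 1.1 at the finite places of a number field -/

section NumberField

/-- **Vignéras II §1 Thm. 1.1, proved at the non-dyadic places**: for a finite place `v ∤ 2` of a
number field `K`, two quaternion algebras over `K_v` which are division rings are
`K_v`-isomorphic — from O'Meara 63:13a at `v ∤ 2` (`index_quadraticNormSubgroup_eq_two` of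
`QuadraticNormIndexLocal`, proved) and `nonempty_algEquiv_of_division_of_index_eq_two`.
[cite: VignerasLNM800, Ch. II §1 Thm. 1.1] -/
theorem nonempty_algEquiv_adicCompletion_of_division_of_not_mem (K : Type) [Field K]
    [NumberField K] (v : HeightOneSpectrum (𝓞 K)) (h2 : (2 : 𝓞 K) ∉ v.asIdeal)
    (A : Type u) [Ring A] [Algebra (v.adicCompletion K) A]
    [IsQuaternionAlgebra (v.adicCompletion K) A]
    (B : Type v) [Ring B] [Algebra (v.adicCompletion K) B]
    [IsQuaternionAlgebra (v.adicCompletion K) B]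
    (hA : ∀ x : A, x ≠ 0 → IsUnit x) (hB : ∀ x : B, x ≠ 0 → IsUnit x) :
    Nonempty (A ≃ₐ[v.adicCompletion K] B) := by
  haveI : CharZero (v.adicCompletion K) :=
    charZero_of_injective_algebraMap (algebraMap K _).injective
  exact nonempty_algEquiv_of_division_of_index_eq_two
    (fun a ha hasq ↦ QuadraticForms.index_quadraticNormSubgroup_eq_two K v h2 ha hasq) A B hA hB

/-- **Vignéras II §1 Thm. 1.1 from O'Meara 63:13a.** If at every finite place `v` of every
number field the norm group of `K_v(√a)`, `a ∈ K_v` a non-square, has index `2` in `K_vˣ`, then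
the named fact `nonempty_algEquiv_adicCompletion_of_division` holds.
[cite: VignerasLNM800, Ch. II §1 Thm. 1.1] -/
theorem nonempty_algEquiv_adicCompletion_of_division_of_index_eq_two
    (hI : ∀ (K : Type) [Field K] [NumberField K] (v : HeightOneSpectrum (𝓞 K))
      (a : v.adicCompletion K), a ≠ 0 → ¬ IsSquare a →
        (QuadraticForms.quadraticNormSubgroup (v.adicCompletion K) a).index = 2) :
    nonempty_algEquiv_adicCompletion_of_division.{u, v} := by
  intro K _ _ v A _ _ _ B _ _ _ hA hB
  haveI : CharZero (v.adicCompletion K) :=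
    charZero_of_injective_algebraMap (algebraMap K _).injective
  exact nonempty_algEquiv_of_division_of_index_eq_two (hI K v) A B hA hB

/-- **Vignéras II §1 Thm. 1.1 from the fundamental equality of local class field theory.** If
`[K_vˣ : N_{E/K_v}(Eˣ)] = [E : K_v]` for the finite abelian extensions `E` of the completions
`K_v` of number fields (Serre, *Local Fields*, XIII §4 Prop. 9; the named fact
`index_normSubgroup_eq_finrank` of `LocalExistenceTheorem`, `K_v` being a non-archimedean local
field by `AdicCompletionLocalField`), then two quaternion division algebras over any `K_v` are
isomorphic: the quadratic case of the equality is O'Meara 63:13a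
(`index_quadraticNormSubgroup_eq_two_of_index_normSubgroup_eq_finrank`, `QuadraticNormLocalCFT`).
[cite: VignerasLNM800, Ch. II §1 Thm. 1.1] -/
theorem nonempty_algEquiv_adicCompletion_of_division_of_index_normSubgroup_eq_finrank
    (h : ∀ (K : Type) [Field K] [NumberField K] (v : HeightOneSpectrum (𝓞 K)),
      GaloisRepresentations.index_normSubgroup_eq_finrank (v.adicCompletion K)) :
    nonempty_algEquiv_adicCompletion_of_division.{u, v} := by
  refine nonempty_algEquiv_adicCompletion_of_division_of_index_eq_two fun K _ _ v a _ hasq ↦ ?_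
  haveI : CharZero (v.adicCompletion K) :=
    charZero_of_injective_algebraMap (algebraMap K _).injective
  exact QuadraticForms.index_quadraticNormSubgroup_eq_two_of_index_normSubgroup_eq_finrank
    (v.adicCompletion K) (h K v) hasq

/-- **The target from its leaves, local uniqueness replaced by local class field theory**:
Vignéras III Thm. 3.1 (uniqueness), `nonempty_algEquiv_of_ramifiedPlaces_eq K D`, follows from
the local fundamental equality (`index_normSubgroup_eq_finrank` at the completions of number
fields), Hasse's norm theorem for quadratic extensions (III Cor. 3.4,
`hilbertSymbol_eq_one_of_forall_completions`) and the embedding criterion III Thm. 3.8 (1)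
(`exists_sq_eq_of_not_isSquare_ramified`), by `nonempty_algEquiv_of_ramifiedPlaces_eq_of_leaves`.
[cite: VignerasLNM800, Ch. III §3 Thm. 3.1] -/
theorem nonempty_algEquiv_of_ramifiedPlaces_eq_of_index_normSubgroup_eq_finrank (K : Type)
    [Field K] [NumberField K] (D : Type u) [Ring D] [Algebra K D]
    (hLCFT : ∀ (K : Type) [Field K] [NumberField K] (v : HeightOneSpectrum (𝓞 K)),
      GaloisRepresentations.index_normSubgroup_eq_finrank (v.adicCompletion K))
    (hN : ∀ a θ : K, hilbertSymbol_eq_one_of_forall_completions K a θ)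
    (h38 : exists_sq_eq_of_not_isSquare_ramified K D)
    (h38' : ∀ (D' : Type v) [Ring D'] [Algebra K D'], exists_sq_eq_of_not_isSquare_ramified K D') :
    nonempty_algEquiv_of_ramifiedPlaces_eq.{u, v} K D :=
  nonempty_algEquiv_of_ramifiedPlaces_eq_of_leaves K D
    (nonempty_algEquiv_adicCompletion_of_division_of_index_normSubgroup_eq_finrank hLCFT)
    hN h38 h38'

end NumberField

end Literature.NumberTheory.Automorphic
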